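import Summits.CriticalPhenomena.PercolationContinuityZ3.Theorems.PercExchangeRateTransportCurveInvariance
import Summits.CriticalPhenomena.PercolationContinuityZ3.Theorems.PercExchangeRateTransportSubcritExchangeUniformityStubSlopePositiveOnCurve
import Summits.CriticalPhenomena.PercolationContinuityZ3.Theorems.PercExchangeRateTransportModelFacts
import Summits.CriticalPhenomena.PercolationContinuityZ3.Theorems.PercExchangeRateTransportCriticalCurveRegular

/-!
# One-sided transport for the crux `SubcritExchangeUniformity` (K⁻, stmt-CriticalPhenomena-16062), line `onesided`:
# INSTANTIATION — `TransportLemmaMono` + K⁺ + the LOWER sub-curve bound (`stub_lowerSubcurveBound`) make the critical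
# jump `t ↦ θ(p_c t, t)` NONINCREASING on compact sub-arcs of `(0,1)`

`ModelFacts` and `CriticalCurveRegular` are tree theorems; K⁺ and the lower sub-curve bound are hypotheses; the
one-sided transport lemma is a hypothesis here (proved in a sibling file). Helper stub `curveMonotone_of_lowerHalf`
registered on stmt-CriticalPhenomena-16062 (lead c1).
-/

noncomputable section

namespace Summit.CriticalPhenomena.PercolationContinuityZ3.Theorems.SubcritExchangeUniformity.TransportMono

open MeasureTheory Filter Topology Set
open Literature.Probability.Percolation Literature.Probability.LatticeModels
open Summit.CriticalPhenomena.PercolationContinuityZ3.Theses.PercExchangeRateTransport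
  (SupercritExchangeUniformity ModelFacts CriticalCurveRegular)
open Summit.CriticalPhenomena.PercolationContinuityZ3.Theorems.PercExchangeRateTransportCurveInvariance
  (stub_collar stub_threshold)

/-! ## §1 The lower-half algebra (division by the positive on-curve slope) -/

/-- **Lower-half algebra.** From the on-curve exchange inequality `|T - σ D| ≤ (η/2) D` (K⁺ at
`p = p_c t`), the cross-multiplied lower sub-curve bound `T d - (η/2) d D ≤ τ D`, `0 ≤ d` and
`0 < D`, the one-sided buffer inequality `(σ - η) d ≤ τ` follows (multiply the first by `d ≥ 0`,
add, divide by `D > 0`).  Here `D = ∂_pΘ_n(p_c t,t)`, `d = ∂_pΘ_n(p,t)`, `T = ∂_tΘ_n(p_c t,t)`,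
`τ = ∂_tΘ_n(p,t)`, `σ = a (p_c t) t`. -/
theorem lowerHalf_algebra {σ η D d T τ : ℝ} (hD : 0 < D) (hd : 0 ≤ d)
    (hA : |T - σ * D| ≤ η / 2 * D) (hB : T * d - η / 2 * d * D ≤ τ * D) :
    (σ - η) * d ≤ τ := by
  have hA' : σ * D - η / 2 * D ≤ T := by
    have := (abs_le.mp hA).1
    linarith
  have h1' : (σ * D - η / 2 * D) * d ≤ T * d := mul_le_mul_of_nonneg_right hA' hd
  have key : ((σ - η) * d) * D ≤ τ * D := by nlinarith
  exact le_of_mul_le_mul_right key hD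

/-! ## §2 The percolation-free composition core -/

/-- **Percolation-free core of the one-sided instantiation.** For an abstract family `Θ n p t`
with `θ = ⨅ n, Θ n`, threshold curve `pc` (the `sInf` formula), the `ModelFacts`-type regularity,
the `CriticalCurveRegular`-type continuity and bounds of `pc` on `(0,1)`, the K⁺ data and the
cross-multiplied LOWER sub-curve bound, the one-sided transport lemma (hypothesis `hTM`) makes
`t ↦ θ (pc t) t` nonincreasing on every compact sub-arc.  The one-sided buffer hypothesis of `hTM`
is fed with K⁺'s own on-curve value `a (pc t) t` (no glued field): K⁺ at `p = pc t`, the lower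
sub-curve bound and `0 < ∂_pΘ_n(pc t, t)` (`n ≥ 1`) give it by `lowerHalf_algebra`. -/
theorem curveMonotone_core
    {Θ : ℕ → ℝ → ℝ → ℝ} {θ : ℝ → ℝ → ℝ} {pc : ℝ → ℝ}
    (hTM : ∀ (Θ : ℕ → ℝ → ℝ → ℝ) (pc : ℝ → ℝ) (a : ℝ → ℝ → ℝ) (lo hi ρ L : ℝ), 0 < lo → lo < hi →
      hi < 1 → 0 < ρ →
      (∀ n, ContDiffOn ℝ 1 (fun x : ℝ × ℝ => Θ n x.1 x.2) (Set.Ioo 0 1 ×ˢ Set.Ioo 0 1)) →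
      (∀ n t, Monotone (fun p => Θ n p t)) → (∀ n p, Monotone (fun t => Θ n p t)) →
      (∀ p t, Antitone (fun n => Θ n p t)) → (∀ n p t, 0 ≤ Θ n p t) →
      ContinuousOn pc (Set.Icc lo hi) → (∀ t ∈ Set.Icc lo hi, ρ < pc t ∧ pc t + ρ < 1) →
      (∀ t ∈ Set.Icc lo hi, ∀ p : ℝ,
        (p < pc t → (⨅ n, Θ n p t) = 0) ∧ (pc t < p → 0 < ⨅ n, Θ n p t)) →
      ContinuousOn (fun x : ℝ × ℝ => a x.1 x.2)
        {x : ℝ × ℝ | x.2 ∈ Set.Icc lo hi ∧ pc x.2 ≤ x.1 ∧ x.1 ≤ pc x.2 + ρ} →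
      (∀ t ∈ Set.Icc lo hi, ∀ p q : ℝ, pc t ≤ p → p ≤ pc t + ρ → pc t ≤ q → q ≤ pc t + ρ →
        |a p t - a q t| ≤ L * |p - q|) →
      (∀ η > (0 : ℝ), ∃ m : ℕ, ∀ n ≥ m, ∀ t ∈ Set.Icc lo hi, ∀ p : ℝ, pc t ≤ p → p ≤ pc t + ρ →
        |deriv (fun s => Θ n p s) t - a p t * deriv (fun q => Θ n q t) p| ≤
          η * deriv (fun q => Θ n q t) p) →
      (∀ η > (0 : ℝ), ∃ δ > (0 : ℝ), ∃ m : ℕ, ∀ n ≥ m, ∀ t ∈ Set.Icc lo hi, ∀ p : ℝ,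
        pc t - δ ≤ p → p ≤ pc t →
          (a (pc t) t - η) * deriv (fun q => Θ n q t) p ≤ deriv (fun s => Θ n p s) t) →
      ∀ s t : ℝ, s ∈ Set.Icc lo hi → t ∈ Set.Icc lo hi → s ≤ t →
        (⨅ n, Θ n (pc t) t) ≤ ⨅ n, Θ n (pc s) s)
    (hinf : ∀ p t, θ p t = ⨅ n, Θ n p t)
    (hpc : ∀ t, pc t = sInf ({p : ℝ | 0 ≤ p ∧ p ≤ 1 ∧ 0 < θ p t} ∪ {1}))
    (hC1 : ∀ n, ContDiffOn ℝ 1 (fun x : ℝ × ℝ => Θ n x.1 x.2) (Set.Ioo 0 1 ×ˢ Set.Ioo 0 1))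
    (hmp : ∀ n t, Monotone (fun p => Θ n p t))
    (hmt : ∀ n p, Monotone (fun t => Θ n p t))
    (hanti : ∀ p t, Antitone (fun n => Θ n p t))
    (h01 : ∀ n p t, 0 ≤ Θ n p t ∧ Θ n p t ≤ 1)
    (hDpos : ∀ n, 1 ≤ n → ∀ p ∈ Set.Ioo (0 : ℝ) 1, ∀ t ∈ Set.Ioo (0 : ℝ) 1,
      0 < deriv (fun q => Θ n q t) p)
    (hpcc : ContinuousOn pc (Set.Ioo 0 1))
    (hpcb : ∀ t ∈ Set.Ioo (0 : ℝ) 1, 0 < pc t ∧ pc t < 1)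
    (hSup : ∀ lo hi : ℝ, 0 < lo → lo < hi → hi < 1 → ∃ ρ > (0 : ℝ), ∃ L : ℝ, ∃ a : ℝ → ℝ → ℝ,
      ContinuousOn (fun x : ℝ × ℝ => a x.1 x.2)
          {x : ℝ × ℝ | x.2 ∈ Set.Icc lo hi ∧ pc x.2 ≤ x.1 ∧ x.1 ≤ pc x.2 + ρ} ∧
        (∀ t ∈ Set.Icc lo hi, ∀ p q : ℝ, pc t ≤ p → p ≤ pc t + ρ → pc t ≤ q → q ≤ pc t + ρ →
          |a p t - a q t| ≤ L * |p - q|) ∧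
        ∀ η > (0 : ℝ), ∃ m : ℕ, ∀ n ≥ m, ∀ t ∈ Set.Icc lo hi, ∀ p : ℝ, pc t ≤ p →
          p ≤ pc t + ρ →
          |deriv (fun s => Θ n p s) t - a p t * deriv (fun q => Θ n q t) p| ≤
            η * deriv (fun q => Θ n q t) p)
    (hLow : ∀ lo hi : ℝ, 0 < lo → lo < hi → hi < 1 → ∀ η > (0 : ℝ), ∃ δ > (0 : ℝ), ∃ m : ℕ,
      ∀ n ≥ m, ∀ t ∈ Set.Icc lo hi, ∀ p : ℝ, pc t - δ ≤ p → p ≤ pc t →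
        deriv (fun s => Θ n (pc t) s) t * deriv (fun q => Θ n q t) p -
            η * deriv (fun q => Θ n q t) p * deriv (fun q => Θ n q t) (pc t) ≤
          deriv (fun s => Θ n p s) t * deriv (fun q => Θ n q t) (pc t)) :
    ∀ lo hi : ℝ, 0 < lo → lo < hi → hi < 1 → ∀ s ∈ Set.Icc lo hi, ∀ t ∈ Set.Icc lo hi, s ≤ t →
      θ (pc t) t ≤ θ (pc s) s := by
  intro lo hi hlo hlohi hhi s hs t ht hst
  have hIcc : ∀ u ∈ Set.Icc lo hi, u ∈ Set.Ioo (0 : ℝ) 1 := fun u hu =>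
    ⟨hlo.trans_le hu.1, lt_of_le_of_lt hu.2 hhi⟩
  have hpcc' : ContinuousOn pc (Set.Icc lo hi) := hpcc.mono fun u hu => hIcc u hu
  have hpcb' : ∀ u ∈ Set.Icc lo hi, 0 < pc u ∧ pc u < 1 := fun u hu => hpcb u (hIcc u hu)
  -- the collar inside the open square (compactness)
  obtain ⟨ρ₀, hρ₀, hρ₀b⟩ := stub_collar pc lo hi hlohi.le hpcc' hpcb'
  -- positivity of the `p`-slope on the curve for `n ≥ 1`
  have hpos : ∀ u ∈ Set.Icc lo hi, ∀ n : ℕ, 1 ≤ n → 0 < deriv (fun q => Θ n q u) (pc u) :=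
    fun u hu n hn => hDpos n hn (pc u) (hpcb' u hu) u (hIcc u hu)
  -- K⁺ on `[lo,hi]`
  obtain ⟨ρ, hρ, L, a, hcont, hlip, hex⟩ := hSup lo hi hlo hlohi hhi
  -- shrink the right collar into the open square
  obtain ⟨ρ', hρ', hρ'le, hρ'le₀⟩ : ∃ ρ' > (0 : ℝ), ρ' ≤ ρ ∧ ρ' ≤ ρ₀ :=
    ⟨min ρ ρ₀, lt_min hρ hρ₀, min_le_left _ _, min_le_right _ _⟩
  have hin : ∀ u ∈ Set.Icc lo hi, ρ' < pc u ∧ pc u + ρ' < 1 := fun u hu =>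
    ⟨lt_of_le_of_lt hρ'le₀ (hρ₀b u hu).1, by linarith [(hρ₀b u hu).2]⟩
  -- the sharp threshold for every real `p`
  have hthr : ∀ u ∈ Set.Icc lo hi, ∀ p : ℝ,
      (p < pc u → (⨅ n, Θ n p u) = 0) ∧ (pc u < p → 0 < ⨅ n, Θ n p u) := fun u hu =>
    stub_threshold Θ θ pc u (fun n => hmp n u) (fun n p => (h01 n p u).1) (fun p => hinf p u)
      (hpc u) (hpcb' u hu).1 (hpcb' u hu).2
  -- K⁺ restricted to the smaller right collar
  have hcont' : ContinuousOn (fun x : ℝ × ℝ => a x.1 x.2)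
      {x : ℝ × ℝ | x.2 ∈ Set.Icc lo hi ∧ pc x.2 ≤ x.1 ∧ x.1 ≤ pc x.2 + ρ'} :=
    hcont.mono fun x hx => ⟨hx.1, hx.2.1, le_trans hx.2.2 (by linarith)⟩
  have hlip' : ∀ u ∈ Set.Icc lo hi, ∀ p q : ℝ, pc u ≤ p → p ≤ pc u + ρ' → pc u ≤ q →
      q ≤ pc u + ρ' → |a p u - a q u| ≤ L * |p - q| := fun u hu p q hp hpρ hq hqρ =>
    hlip u hu p q hp (by linarith) hq (by linarith)
  have hex' : ∀ η > (0 : ℝ), ∃ m : ℕ, ∀ n ≥ m, ∀ u ∈ Set.Icc lo hi, ∀ p : ℝ, pc u ≤ p →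
      p ≤ pc u + ρ' →
      |deriv (fun s => Θ n p s) u - a p u * deriv (fun q => Θ n q u) p| ≤
        η * deriv (fun q => Θ n q u) p := by
    intro η hη
    obtain ⟨m, hm⟩ := hex η hη
    exact ⟨m, fun n hn u hu p hp hpρ => hm n hn u hu p hp (by linarith)⟩
  -- THE ONE-SIDED LOWER BUFFER below the curve, with K⁺'s on-curve value `a (pc u) u`
  have hexL : ∀ η > (0 : ℝ), ∃ δ > (0 : ℝ), ∃ m : ℕ, ∀ n ≥ m, ∀ u ∈ Set.Icc lo hi, ∀ p : ℝ,
      pc u - δ ≤ p → p ≤ pc u →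
        (a (pc u) u - η) * deriv (fun q => Θ n q u) p ≤ deriv (fun s => Θ n p s) u := by
    intro η hη
    have hη2 : (0 : ℝ) < η / 2 := half_pos hη
    obtain ⟨m₁, hm₁⟩ := hex (η / 2) hη2
    obtain ⟨δ, hδ, m₂, hm₂⟩ := hLow lo hi hlo hlohi hhi (η / 2) hη2
    refine ⟨δ, hδ, max (max m₁ m₂) 1, fun n hn u hu p hp₁ hp₂ => ?_⟩
    have hn₁ : m₁ ≤ n := le_trans ((le_max_left _ _).trans (le_max_left _ _)) hn
    have hn₂ : m₂ ≤ n := le_trans ((le_max_right _ _).trans (le_max_left _ _)) hn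
    have hn₄ : 1 ≤ n := le_trans (le_max_right _ _) hn
    have hD : 0 < deriv (fun q => Θ n q u) (pc u) := hpos u hu n hn₄
    have hd : 0 ≤ deriv (fun q => Θ n q u) p := (hmp n u).deriv_nonneg
    have hA := hm₁ n hn₁ u hu (pc u) le_rfl (by linarith)
    have hB := hm₂ n hn₂ u hu p hp₁ hp₂
    exact lowerHalf_algebra hD hd hA hB
  -- apply the one-sided transport lemma
  have key := hTM Θ pc a lo hi ρ' L hlo hlohi hhi hρ' hC1 hmp hmt hanti (fun n p t => (h01 n p t).1)
    hpcc' hin hthr hcont' hlip' hex' hexL s t hs ht hst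
  rw [hinf, hinf]
  exact key

/-! ## §3 The instantiation on the label-coupled family -/

-- The registered signature's conclusion carries the route's full `let` preamble, whose binder `Θ`
-- is not referenced by `θ (pc t) t ≤ θ (pc s) s` (the header is matched textually, so it stays).
set_option linter.unusedVariables false in
/-- **One-sided curve transport.** `TransportLemmaMono → K⁺ → stub_lowerSubcurveBound → J nonincreasing on compact
sub-arcs` (`J t = θ (p_c t) t`). -/
theorem curveMonotone_of_lowerHalf : (∀ (Θ : ℕ → ℝ → ℝ → ℝ) (pc : ℝ → ℝ) (a : ℝ → ℝ → ℝ) (lo hi ρ L : ℝ), 0 < lo → lo < hi → hi < 1 → 0 < ρ → (∀ n, ContDiffOn ℝ 1 (fun x : ℝ × ℝ => Θ n x.1 x.2) (Set.Ioo 0 1 ×ˢ Set.Ioo 0 1)) → (∀ n t, Monotone (fun p => Θ n p t)) → (∀ n p, Monotone (fun t => Θ n p t)) → (∀ p t, Antitone (fun n => Θ n p t)) → (∀ n p t, 0 ≤ Θ n p t) → ContinuousOn pc (Set.Icc lo hi) → (∀ t ∈ Set.Icc lo hi, ρ < pc t ∧ pc t + ρ < 1) → (∀ t ∈ Set.Icc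 lo hi, ∀ p : ℝ, (p < pc t → (⨅ n, Θ n p t) = 0) ∧ (pc t < p → 0 < ⨅ n, Θ n p t)) → ContinuousOn (fun x : ℝ × ℝ => a x.1 x.2) {x : ℝ × ℝ | x.2 ∈ Set.Icc lo hi ∧ pc x.2 ≤ x.1 ∧ x.1 ≤ pc x.2 + ρ} → (∀ t ∈ Set.Icc lo hi, ∀ p q : ℝ, pc t ≤ p → p ≤ pc t + ρ → pc t ≤ q → q ≤ pc t + ρ → |a p t - a q t| ≤ L * |p - q|) → (∀ η > (0 : ℝ), ∃ m : ℕ, ∀ n ≥ m, ∀ t ∈ Set.Icc lo hi, ∀ p : ℝ, pc t ≤ p → p ≤ pc t + ρ → |deriv (fun s => Θ n p s) t - a p t * deriv (fun q => Θ n q t) p| ≤ η * deriv (fun q => Θ n q t) p) → (∀ η > (0 : ℝ), ∃ δ > (0 : ℝ), ∃ m : ℕ, ∀ n ≥ m, ∀ t ∈ Set.Icc lo hi, ∀ p : ℝ, pc t - δ ≤ p → p ≤ pc t → (a (pc t) t - η) * deriv (fun q => Θ n q t) p ≤ deriv (fun s => Θ n p s) t) → ∀ s t : ℝ, s ∈ Set.Icc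 lo hi → t ∈ Set.Icc lo hi → s ≤ t → (⨅ n, Θ n (pc t) t) ≤ ⨅ n, Θ n (pc s) s) → Summit.CriticalPhenomena.PercolationContinuityZ3.Theses.PercExchangeRateTransport.SupercritExchangeUniformity → (let μ := labelMeasure (Site 3); let vert : Sym2 (Site 3) → Prop := fun e => ∃ x : Site 3, e = s(x, x + Pi.single (2 : Fin 3) 1); let cfg : ℝ → ℝ → (Sym2 (Site 3) → ℝ) → Set (Sym2 (Site 3)) := fun p t U => {e | e ∈ (zdGraph 3).edgeSet ∧ ((vert e ∧ U e ≤ t) ∨ (¬ vert e ∧ U e ≤ p))}; let Θ : ℕ → ℝ → ℝ → ℝ := fun n p t => μ.real {U | cfg p t U ∈ siteToBoundary 3 n}; let θ : ℝ → ℝ → ℝ := fun p t => μ.real {U | cfg p t U ∈ percolatesAt (0 : Site 3)}; let pc : ℝ → ℝ := fun t => sInf ({p : ℝ | 0 ≤ p ∧ p ≤ 1 ∧ 0 < θ p t} ∪ {1}); ∀ lo hi : ℝ, 0 < lo → lo < hi → hi < 1 → ∀ η > (0 : ℝ), ∃ δ > (0 : ℝ), ∃ m : ℕ, ∀ n ≥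 m, ∀ t ∈ Set.Icc lo hi, ∀ p : ℝ, pc t - δ ≤ p → p ≤ pc t → deriv (fun s => Θ n (pc t) s) t * deriv (fun q => Θ n q t) p - η * deriv (fun q => Θ n q t) p * deriv (fun q => Θ n q t) (pc t) ≤ deriv (fun s => Θ n p s) t * deriv (fun q => Θ n q t) (pc t)) → let μ := labelMeasure (Site 3); let vert : Sym2 (Site 3) → Prop := fun e => ∃ x : Site 3, e = s(x, x + Pi.single (2 : Fin 3) 1); let cfg : ℝ → ℝ → (Sym2 (Site 3) → ℝ) → Set (Sym2 (Site 3)) := fun p t U => {e | e ∈ (zdGraph 3).edgeSet ∧ ((vert e ∧ U e ≤ t) ∨ (¬ vert e ∧ U e ≤ p))}; let Θ : ℕ → ℝ → ℝ → ℝ := fun n p t => μ.real {U | cfg p t U ∈ siteToBoundary 3 n}; let θ : ℝ → ℝ → ℝ := fun p t => μ.real {U | cfg p t U ∈ percolatesAt (0 : Site 3)}; let pc : ℝ → ℝ := fun t => sInf ({p : ℝ | 0 ≤ p ∧ p ≤ 1 ∧ 0 < θ p t} ∪ {1}); ∀ lo hi : ℝ, 0 < lo → lo < hi → hi < 1 →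 ∀ s ∈ Set.Icc lo hi, ∀ t ∈ Set.Icc lo hi, s ≤ t → θ (pc t) t ≤ θ (pc s) s := by
  intro hTM hSup hLow
  -- the model bookkeeping and the regularity of the critical curve are tree theorems
  obtain ⟨-, hC1, hmp, hmt, hanti, h01, hinf, hDpos, -, -⟩ :=
    Summit.CriticalPhenomena.PercolationContinuityZ3.Theorems.ModelFacts.modelFacts_proof
  obtain ⟨hpcc, hpcb⟩ :=
    Summit.CriticalPhenomena.PercolationContinuityZ3.Cruxes.CriticalCurveRegular.Locmod.CriticalCurveRegular_proof
  intro μ vert cfg Θ θ pc lo hi hlo hlohi hhi s hs t ht hst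
  exact curveMonotone_core hTM hinf (fun _ => rfl) hC1 hmp hmt hanti h01 hDpos hpcc hpcb hSup hLow lo hi
    hlo hlohi hhi s hs t ht hst

end Summit.CriticalPhenomena.PercolationContinuityZ3.Theorems.SubcritExchangeUniformity.TransportMono

end
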